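import Summits.CriticalPhenomena.PercolationContinuityZ3.Theorems.PercNearOneGluingNoHeavyQuantSingleGatePointPieces
import Summits.CriticalPhenomena.PercolationContinuityZ3.Theorems.PercNearOneGluingNoHeavyQuantSliceLawSWHolds
import HarnessLib

/-!
# QUANT lane R8, T-DEC, the q < 1 slice of `SingleGateConvClosed`: the CREDIT-PAIR PIECES and the GIANT-TOPPED ZERO PIECES of the
# single-gate reassembly are DEC at the global target, for a GENERAL second factor — so the piece-wise map of the q < 1 slice in the
# kernel leaves exactly the mid-topped DEAD-ZERO pieces (the zero budget) and the LIGHT credit pairs (leg (II)'s residue)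

builds on p205010 (kernel theorem, internal audit signed; external expert review pending)

Support file (`--supports stmt-CriticalPhenomena-4575`), QUANT lane seat prim-quant-arm-2 (gen 33), rung R8 of
`run/shared/lean/prim/quant/LADDER.md`; memos `run/shared/lean/prim/quant/FOR-PROVERS-SINGLE-GATE.md` §5 and
`run/shared/lean/prim/quant/prim-quant-arm-2-g32/SGC-PIECES-G32.md` §0/§4 (piece anatomy Z / N / K of the q < 1 slice, exact census for a
two-point second factor: K 0 / 1 340 879, N 908 / 223 720, Z 215 259 / 1 165 996 standalone failures, Z of word LGG 0 / ≈ 970 000).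
Theorems only (no definitions), standard axioms, no sorries.  Continues this seat's `…QuantSingleGatePointPieces` (K pieces; de-gating).

WHAT.  Over a DEC datum `ν = gate_q μ₁ = Σ λ_i C_i` (`μ₁` empty-free) the gated convolution of `SingleGateConvClosed` splits into pieces
(lead g28, `gateConv_eq_pieces`): points `k ↦ μ₂(· − k)` (K), pairs `{lo, hi; γ}` with `lo ≥ 1` ↦ `(1−γ)μ₂(·−lo) + γμ₂(·−hi)` (N), zero pairs
`{0, hi; γ}` ↦ `(1−γ)δ₀ + γμ₂(·−hi) = gate_γ(μ₂(·−hi))` (Z, the dead zero atom of `ν` stays at `0`).  This file proves, from the single-gate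
hypothesis on `μ₂` alone (`gate μ₂ q` top-affordable and DEC at every layer at floor `y`, `T₂` the mean of `μ₂`):

* **`LawDec.decAtT_sliceFactor_allLayers`** — the second factor SLICED by a heavy blob, `slice μ₂ a γ = (1−γ)μ₂ + γμ₂(·−a)` (`y ≤ γ ≤ 1`,
  `a ≥ 1`), is `DECAtT y (q·T₂ + a·γ) J (M₂ + a)` at EVERY layer `J`: de-gate (`decAtT_of_decAtT_gate`, arm-2 g33) to get `μ₂` DEC at target
  `q·T₂` at every layer, then census-2/typer's SLICE THEOREM `sliceClosedWindowT_holds` (explicit target, any law) below the top and Theorem A above.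
* **`LawDec.decAtT_creditPiece`** — THE HEAVY CREDIT-PAIR PIECES ARE DEC: for `lo < hi`, `y ≤ γ ≤ 1` and a target
  `T ≤ 2lo + (hi − lo)γ + q·T₂` the piece `(1−γ)μ₂(·−lo) + γμ₂(·−hi)` is `DECAtT y T j M′` at EVERY layer `j` (`M′ ≥ hi + M₂`): it is the
  slice shifted by `lo` (`decAtT_shift_two`, double target bonus `2lo`).  A heavy credit pair of `ν`'s datum at target `q·T₁` has
  `2lo + (hi−lo)γ ≥ q·T₁`, so its N piece is DEC at the global target `q·T₁ + q·T₂` — the kernel reason for "N pieces fail only when light /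
  low-bottomed" (908 / 223 720).  (For `lo = 0` this is the piece of an ALIVE zero pair; the dead zero of `ν` gives `gate_γ` instead.)
* **`LawDec.decAtT_gate_giantTopped`** — THE GIANT-TOPPED DEAD-ZERO PIECES ARE DEC at ANY target: `gate (μ₂(· − hi)) γ` with `γ ≥ y` and
  `hi ≥ j + 1` (word LGG; criterion E `y(1−γ) ≤ γ(1−y)`).
With `decAtT_shiftedFactor` / `pointPiece_decAtT` (K) this is the kernel form of arm-2 g32's census reading: at a layer `j < M₁` (datum layer `j`)
every piece is DEC except the dead-zero pieces topped by a MID `hi ≤ j` (the zero budget, FOR-PROVERS-SINGLE-GATE §5 (ii)) and the LIGHT credit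
pairs (`γ < y`, leg (II)'s residue `LightSliceLowCross ∧ LightSliceWide`); at layers `j ≥ M₁` (datum layer `M₁ − 1`) the giant pairs topped at
`M₁` lose their giant as well.  HONEST STATUS: `SingleGateConvClosed` and both slices remain OPEN; RATE class log\* and the honest sentence unchanged.

[this work]; slice theorem: prim-quant-census-2 g54–g56 / prim-quant-stmt (this lane, `sliceClosedWindowT_holds`); shift lemma: census-2 g56;
reassembly: lead g28.  Nothing here is cited as a published result.  The gluing rows served [cite: KozmaNitzan2024, Conjecture 3 (p. 15)];
product measure [cite: Grimmett1999, §1.3 p. 10].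
-/

noncomputable section

namespace Summit.CriticalPhenomena.PercolationContinuityZ3.Theorems

namespace Quant

open Finset

namespace LawDec

/-! ### The sliced second factor at every layer -/

/-- **THE SECOND FACTOR SLICED BY A HEAVY BLOB IS DEC AT EVERY LAYER AT TARGET `q·T₂ + a·γ`.**  `0 < y < 1`, `0 < q ≤ 1`, `y ≤ γ ≤ 1`,
`a ≥ 1`; `μ₂` a probability law on `{0..M₂}` (mean `T₂`) with `gate μ₂ q` top-affordable at `y` and DEC at every layer `j′ < M₂`.  Then
`DECAtT y (q·T₂ + a·γ) J (M₂ + a) (slice μ₂ a γ)` for every `J`: `μ₂` is DEC at target `q·T₂` at every layer (de-gating + Theorem A), so the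
slice theorem applies below the top `M₂ + a`; at and above it, Theorem A for the slice law and `q·T₂ ≤ T₂`. [this work] -/
theorem decAtT_sliceFactor_allLayers (y q γ : ℝ) (a M₂ : ℕ) (μ₂ : ℕ → ℝ) (hy0 : 0 < y) (hy1 : y < 1) (hq0 : 0 < q)
    (hq1 : q ≤ 1) (hyγ : y ≤ γ) (hγ1 : γ ≤ 1) (ha : 1 ≤ a)
    (hμ0 : ∀ h, 0 ≤ μ₂ h) (hμM : ∀ h, M₂ < h → μ₂ h = 0) (hμ1 : ∑ h ∈ Finset.range (M₂ + 1), μ₂ h = 1)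
    (hta : y * (M₂ : ℝ) ≤ q * ∑ h ∈ Finset.range (M₂ + 1), (h : ℝ) * μ₂ h)
    (hdec : ∀ j', j' < M₂ → DECAt y j' M₂ (gate μ₂ q)) (J : ℕ) :
    DECAtT y (q * ∑ h ∈ Finset.range (M₂ + 1), (h : ℝ) * μ₂ h + (a : ℝ) * γ) J (M₂ + a) (slice μ₂ a γ) := by
  set T₂ := ∑ h ∈ Finset.range (M₂ + 1), (h : ℝ) * μ₂ h with hT₂
  have hμdec : ∀ j'', DECAtT y (q * T₂) j'' M₂ μ₂ := fun j'' =>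
    decAtT_of_decAtT_gate y (q * T₂) q j'' M₂ μ₂ hy0 hy1 hq0 hq1 hμ0 hμM hμ1
      (decAtT_gate_allLayers y q M₂ μ₂ hy0 hy1 hq0 hq1 hμ0 hμM hμ1 hta hdec j'')
  by_cases hJ : J < M₂ + a
  · exact sliceClosedWindowT_holds y γ (q * T₂) M₂ a J μ₂ hy0 hy1 hyγ hγ1 ha hμ0 hμM hμ1 hJ (fun j'' _ _ => hμdec j'')
  · have hγ0 : 0 ≤ γ := hy0.le.trans hyγ
    have s0 := slice_nonneg μ₂ a γ hγ0 hγ1 hμ0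
    have sM := slice_eq_zero μ₂ a γ M₂ hμM
    have s1 := sum_slice μ₂ a γ M₂ hμM hμ1
    have smean := sum_mul_slice μ₂ a γ M₂ hμM hμ1
    have hT₂0 : 0 ≤ T₂ := Finset.sum_nonneg fun h _ => mul_nonneg (Nat.cast_nonneg h) (hμ0 h)
    have hqT : q * T₂ ≤ T₂ := by nlinarith
    have htop : ∀ h, 0 < slice μ₂ a γ h → y * (h : ℝ) ≤ ∑ t ∈ Finset.range (M₂ + a + 1), (t : ℝ) * slice μ₂ a γ t := by
      intro h hh
      rw [smean]
      have hhM : (h : ℝ) ≤ M₂ + a := by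
        have : h ≤ M₂ + a := by
          by_contra hc
          exact hh.ne' (sM h (by omega))
        exact_mod_cast this
      have ha' : y * (a : ℝ) ≤ (a : ℝ) * γ := by nlinarith [(Nat.cast_nonneg a : (0 : ℝ) ≤ a)]
      nlinarith
    have hA := decAt_of_top_le (M₂ + a) (slice μ₂ a γ) s0 sM s1 y hy1 htop J (by omega)
    rw [decAt_iff_decAtT, smean] at hA
    exact decAtT_antitone_target (by linarith) hA

/-! ### Credit-pair pieces -/

/-- **THE HEAVY CREDIT-PAIR PIECES ARE DEC.**  Under the single-gate hypothesis on `μ₂` (as above), for `lo < hi`, a heavy gate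
`y ≤ γ ≤ 1` and a target `T ≤ 2lo + (hi − lo)·γ + q·T₂`, the piece `(1−γ)·μ₂(· − lo) + γ·μ₂(· − hi)` is `DECAtT y T j M′` at every layer
`j` (`M′ ≥ hi + M₂`): it is the slice `slice μ₂ (hi−lo) γ` shifted by `lo` (layers `j ≥ lo`: `decAtT_sliceFactor_allLayers` at `j − lo`,
`decAtT_shift_two`, lower the target; layers `j < lo`: every charged atom is a giant). [this work] -/
theorem decAtT_creditPiece (y q γ T : ℝ) (j lo hi M₂ M' : ℕ) (μ₂ : ℕ → ℝ) (hy0 : 0 < y) (hy1 : y < 1) (hq0 : 0 < q)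
    (hq1 : q ≤ 1) (hyγ : y ≤ γ) (hγ1 : γ ≤ 1)
    (hμ0 : ∀ h, 0 ≤ μ₂ h) (hμM : ∀ h, M₂ < h → μ₂ h = 0) (hμ1 : ∑ h ∈ Finset.range (M₂ + 1), μ₂ h = 1)
    (hta : y * (M₂ : ℝ) ≤ q * ∑ h ∈ Finset.range (M₂ + 1), (h : ℝ) * μ₂ h)
    (hdec : ∀ j', j' < M₂ → DECAt y j' M₂ (gate μ₂ q)) (hlohi : lo < hi) (hM' : hi + M₂ ≤ M')
    (hT : T ≤ 2 * (lo : ℝ) + ((hi : ℝ) - lo) * γ + q * ∑ h ∈ Finset.range (M₂ + 1), (h : ℝ) * μ₂ h) :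
    DECAtT y T j M' (fun t => (1 - γ) * (if lo ≤ t then μ₂ (t - lo) else 0) + γ * (if hi ≤ t then μ₂ (t - hi) else 0)) := by
  obtain ⟨d, hd⟩ : ∃ d, hi = lo + d := ⟨hi - lo, by omega⟩
  have hd1 : 1 ≤ d := by omega
  have hγ0 : 0 ≤ γ := hy0.le.trans hyγ
  -- the piece is the slice shifted by `lo`
  have hpiece : (fun t => (1 - γ) * (if lo ≤ t then μ₂ (t - lo) else 0) + γ * (if hi ≤ t then μ₂ (t - hi) else 0))
      = fun t => if lo ≤ t then slice μ₂ d γ (t - lo) else 0 := by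
    funext t
    by_cases hlt : lo ≤ t
    · by_cases hht : hi ≤ t
      · simp only [slice, if_pos hlt, if_pos hht, if_pos (show d ≤ t - lo by omega), show t - lo - d = t - hi by omega]
      · simp only [slice, if_pos hlt, if_neg hht, if_neg (show ¬ d ≤ t - lo by omega)]
    · simp only [if_neg hlt, if_neg (show ¬ hi ≤ t by omega), mul_zero, add_zero]
  rw [hpiece]
  have s0 := slice_nonneg μ₂ d γ hγ0 hγ1 hμ0
  have sM := slice_eq_zero μ₂ d γ M₂ hμM
  have s1 := sum_slice μ₂ d γ M₂ hμM hμ1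
  by_cases hjlo : j < lo
  · -- every charged atom `≥ lo > j` is a giant
    obtain ⟨L0, LM, L1, -⟩ := shift_laws lo (M₂ + d) (slice μ₂ d γ) s0 sM s1
    refine decAtT_mono_top (decAtT_of_flowAtT y T j (lo + (M₂ + d)) _ hy0 hy1 LM L1
      (flowAtT_of_noLow y T j (lo + (M₂ + d)) _ L0 fun l hlj _ => ?_)) (by omega)
    show (if lo ≤ l then slice μ₂ d γ (l - lo) else 0) = 0
    rw [if_neg (by omega)]
  · push Not at hjlo
    obtain ⟨J, rfl⟩ := Nat.exists_eq_add_of_le hjlo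
    have hX := decAtT_sliceFactor_allLayers y q γ d M₂ μ₂ hy0 hy1 hq0 hq1 hyγ hγ1 hd1 hμ0 hμM hμ1 hta hdec J
    have h2 := decAtT_shift_two y _ J (M₂ + d) lo (slice μ₂ d γ) hX
    rw [Nat.add_comm lo J]
    refine decAtT_mono_top (decAtT_antitone_target ?_ h2) (by omega)
    have e : ((hi : ℝ) - lo) = d := by rw [hd]; push_cast; ring
    rw [e] at hT
    linarith

/-! ### Giant-topped dead-zero pieces -/

/-- **THE GIANT-TOPPED DEAD-ZERO PIECES ARE DEC AT ANY TARGET** (word LGG of arm-2 g32's census, 0 / ≈ 970 000): for any probability law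
`μ₂` on `{0..M₂}`, a depth `hi ≥ j + 1` and a gate `y ≤ γ ≤ 1`, the zero piece `gate (μ₂(· − hi)) γ = (1−γ)δ₀ + γ·μ₂(· − hi)` is
`DECAtT y T j M′` (`M′ ≥ hi + M₂`) for EVERY `T`: its only atom at or below the layer is `0` (mass `1−γ`), the rest (`γ`) is giant, and
criterion E reads `y(1−γ) ≤ γ(1−y)`, i.e. `y ≤ γ` (`flowAtT_of_giants`). [this work] -/
theorem decAtT_gate_giantTopped (y T γ : ℝ) (j hi M₂ M' : ℕ) (μ₂ : ℕ → ℝ) (hy0 : 0 < y) (hy1 : y < 1)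
    (hyγ : y ≤ γ) (hγ1 : γ ≤ 1) (hμ0 : ∀ t, 0 ≤ μ₂ t) (hμM : ∀ t, M₂ < t → μ₂ t = 0)
    (hμ1 : ∑ t ∈ Finset.range (M₂ + 1), μ₂ t = 1) (hhi : j + 1 ≤ hi) (hM' : hi + M₂ ≤ M') :
    DECAtT y T j M' (gate (fun t => if hi ≤ t then μ₂ (t - hi) else 0) γ) := by
  have hγ0 : 0 ≤ γ := hy0.le.trans hyγ
  obtain ⟨b0, bM, b1, -⟩ := shift_laws hi M₂ μ₂ hμ0 hμM hμ1
  set B : ℕ → ℝ := fun t => if hi ≤ t then μ₂ (t - hi) else 0 with hB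
  obtain ⟨g0, gM, g1⟩ := gate_laws (hi + M₂) B γ hγ0 hγ1 b0 bM b1
  have gM' : ∀ t, M' < t → gate B γ t = 0 := fun t ht => gM t (by omega)
  have g1' : ∑ t ∈ Finset.range (M' + 1), gate B γ t = 1 := by
    rw [RootDec.sum_range_eq_of_vanish (gate B γ) (hi + M₂) M' hM' gM, g1]
  refine decAtT_of_flowAtT y T j M' _ hy0 hy1 gM' g1' (flowAtT_of_giants y T j M' _ hy0 hy1 g0 ?_)
  have h1y : 0 < 1 - y := by linarith
  have hBlow : ∀ l, l ≤ j → B l = 0 := fun l hl => by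
    simp only [hB, if_neg (show ¬ hi ≤ l by omega)]
  -- the lows carry at most the dead zero `1 − γ`
  have hlow : ∑ l ∈ Finset.range (j + 1), (if 2 * (l : ℝ) < T then gate B γ l else 0) ≤ 1 - γ := by
    calc ∑ l ∈ Finset.range (j + 1), (if 2 * (l : ℝ) < T then gate B γ l else 0)
        ≤ ∑ l ∈ Finset.range (j + 1), (1 - γ) * (if l = 0 then (1 : ℝ) else 0) := Finset.sum_le_sum fun l hl => by
          have hl' : l ≤ j := by have := Finset.mem_range.1 hl; omega
          have e : gate B γ l = (1 - γ) * (if l = 0 then (1 : ℝ) else 0) := by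
            rw [gate_apply, hBlow l hl', mul_zero, zero_add]
          split_ifs with h1 h2 h2
          · rw [e, if_pos h2]
          · rw [e, if_neg h2]
          · rw [mul_one]; linarith
          · rw [mul_zero]
      _ = 1 - γ := by
          rw [← Finset.mul_sum, Finset.sum_ite_eq' (Finset.range (j + 1)) 0, if_pos (Finset.mem_range.2 (by omega)), mul_one]
  -- the giants carry `γ`
  have hB1 : ∑ t ∈ Finset.range (M' + 1), B t = 1 := by
    rw [RootDec.sum_range_eq_of_vanish B (hi + M₂) M' hM' bM, b1]
  have hBg : ∑ h ∈ Finset.Ico (j + 1) (M' + 1), B h = 1 := by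
    have := Finset.sum_range_add_sum_Ico B (show j + 1 ≤ M' + 1 by omega)
    rw [hB1, Finset.sum_eq_zero (fun l hl => hBlow l (by have := Finset.mem_range.1 hl; omega)), zero_add] at this
    exact this
  have hgiant : γ ≤ ∑ h ∈ Finset.Ico (j + 1) (M' + 1), gate B γ h := by
    have e : ∀ h ∈ Finset.Ico (j + 1) (M' + 1), gate B γ h = γ * B h := by
      intro h hh
      rw [Finset.mem_Ico] at hh
      rw [gate_apply, if_neg (by omega), mul_zero, add_zero]
    rw [Finset.sum_congr rfl e, ← Finset.mul_sum, hBg, mul_one]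
  have hE : y / (1 - y) * (1 - γ) ≤ γ := by
    rw [div_mul_eq_mul_div, div_le_iff₀ h1y]; nlinarith
  exact ((mul_le_mul_of_nonneg_left hlow (div_nonneg hy0.le h1y.le)).trans hE).trans hgiant

end LawDec

end Quant

end Summit.CriticalPhenomena.PercolationContinuityZ3.Theorems
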